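import Summits.BirchSwinnertonDyer.BirchSwinnertonDyer.Theses.LeadingTerm
import Literature.NumberTheory.EllipticCurves.Sha
import Literature.NumberTheory.EllipticCurves.BSDSha
import Literature.NumberTheory.EllipticCurves.Selmer
import Literature.NumberTheory.EllipticCurves.KuriharaNumber
import Literature.NumberTheory.EllipticCurves.KatoKolyvaginPrimes
import Literature.NumberTheory.EllipticCurves.Tamagawa
import Literature.NumberTheory.EllipticCurves.OpenImage

/-!
# Crux `TamePinchR` (stmt-BirchSwinnertonDyer-17007) — crux-ideate sketch (round 1, ideator 1)

First-lemma signatures for two idea cards: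

* `KimChebotarevPeeling` — TRANSFER of the crux to the core
  `Core` ("every non-CM `E/ℚ` has ONE Kim-good admissible prime `p` with `Ш(E)[p] = 0`"):
  `ShaPTorsionFree`, `IsKimGood`, `Core`, the fact-shape `KimSharpLevelFact` (Kim 2022 Thm 1.11,
  last clause, + IMC), `PeelingGlue` (the composition Prop), and the PROVED lemmas
  `exists_shaPTorsionFree_of_finite` (a finite `Ш` misses all but finitely many primes of any
  infinite set) and `core_of_finite_sha` (`Core ⟸` finiteness of `Ш` for non-CM curves + an
  infinite supply of Kim-good primes).
* `HeegnerTwin` — the Heegner-side twin of the pinch: `SelmerCountBound` (the counting squeeze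
  `#Sel_p ≤ p^rank ∧ E(ℚ)[p] = 0 ⇒ Ш[p] = 0`, Prop over the tree's Selmer vocabulary) and the
  fact-shape `KolyvaginDepthBound` over a POSITED predicate `Indiv` (D-request: derived Heegner
  point `D_n y_n` not `p`-divisible in `E(K[n])`).
-/

noncomputable section

open scoped Classical

-- D-0017: single-problem summit, the namespace repeats `BirchSwinnertonDyer` by design.
set_option linter.dupNamespace false

namespace Summit.BirchSwinnertonDyer.BirchSwinnertonDyer.Cruxes.TamePinchR

open Literature.NumberTheory.EllipticCurves Literature.NumberTheory.EllipticCurves.ModularForms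
open Summit.BirchSwinnertonDyer.BirchSwinnertonDyer.Theses
open WeierstrassCurve CongruenceSubgroup

/-! ## Card 1: `kim-chebotarev-peeling` -/

namespace KimChebotarevPeeling

/-- `Ш(E/ℚ)` has no element of order `p` (`Ш[p] = 0`). -/
def ShaPTorsionFree (W : WeierstrassCurve ℚ) (p : ℕ) : Prop :=
  ∀ c ∈ W.sha, p • c = 0 → c = 0

/-- Kim's side conditions at `p` (arXiv:2203.12159 Thm 1.11) inside the admissible range of the
crux: `p ≥ 5`, good ORDINARY (so that the IMC is a theorem: Kato + Skinner–Urban + Wan, Kim p. 3),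
`ρ̄_{E,p}` onto `GL₂(𝔽_p)`, non-anomalous (`a_p ≢ 1`, i.e. `E(ℚ_p)[p] = 0` at good ordinary `p ≥ 5`),
and `p ∤ ∏ c_v`. (The Manin/period normalisation is absorbed: the tree's `ratPlusSymbol` is
`Ω⁺_f`-normalised and `p`-integral for `E[p]` irreducible, `IsNewformOf.norm_ratPlusSymbol_le_one`.) -/
def IsKimGood (W : WeierstrassCurve ℚ) [W.IsGloballyMinimal] (p : ℕ) [Fact p.Prime] : Prop :=
  5 ≤ p ∧ IsOrdinaryAt W p ∧ W.HasSurjectiveModNGaloisRep (p : ℤ) ∧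
    ¬ (W.frobeniusTrace p ≡ 1 [ZMOD (p : ℤ)]) ∧ ¬ p ∣ W.tamagawaProduct

/-- **The core `C⁺` of the crux.** Every non-CM elliptic curve over `ℚ` has ONE Kim-good
admissible prime at which `Ш` has no `p`-torsion. -/
def Core : Prop :=
  ∀ (W : WeierstrassCurve ℚ) [W.IsElliptic] [W.IsGloballyMinimal], ¬ W.HasCM →
    ∃ (p : ℕ) (_ : Fact p.Prime), IsKimGood W p ∧ ShaPTorsionFree W p

/-- **Fact shape (Kim 2022, Thm 1.11, last clause, with the IMC at good ordinary admissible `p`):**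
at a Kim-good prime with `Ш(E)[p] = 0`, some square-free product `n ∈ 𝒩₁` of EXACTLY
`rank_ℤ E(ℚ)` Kolyvagin primes carries a non-zero mod-`p` Kurihara number for some (equivalently
every) choice of surjective discrete logarithms. To be vendored as a named Literature fact. -/
def KimSharpLevelFact : Prop :=
  ∀ (W : WeierstrassCurve ℚ) [W.IsElliptic] [W.IsGloballyMinimal] (p : ℕ) [Fact p.Prime],
    IsKimGood W p → ShaPTorsionFree W p →
    ∀ ⦃N : ℕ⦄ [NeZero N] (f : CuspForm (Gamma0 N) 2), IsNewformOf W f →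
      ∃ (n : ℕ) (_ : NeZero n), Kato.IsKolyvaginProduct W p 1 n ∧
        n.primeFactors.card = W.mordellWeilRank ∧
        ∃ ψ : (ℓ : ℕ) → (ZMod ℓ)ˣ →* Multiplicative (ZMod p),
          (∀ ℓ ∈ n.primeFactors, Function.Surjective (ψ ℓ)) ∧ kuriharaNumber f p n ψ ≠ 0

/-- An infinite supply of Kim-good admissible primes for every non-CM curve (Serre 1972 open image;
ordinary primes of density one and `a_p = 1` of density zero for non-CM `E`, Serre 1981; finitely
many `p ∣ ∏ c_v`). Fact shape, provable from named facts. -/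
def KimGoodSupply : Prop :=
  ∀ (W : WeierstrassCurve ℚ) [W.IsElliptic] [W.IsGloballyMinimal], ¬ W.HasCM →
    {p : ℕ | ∃ _ : Fact p.Prime, IsKimGood W p}.Infinite

/-- The GLUE of the line (provable now, bookkeeping: `kuriharaNumber_eq_sum_ratCast`,
`Kato.isKolyvaginPrime_one_iff`, `IsNewformOf.level_eq_conductorNorm`, `exists_isNewformOf`):
Kim's sharp level at a core prime is literally the witness the crux asks for. -/
def PeelingGlue : Prop :=
  KimSharpLevelFact → exists_isNewformOf →
    (∀ {N : ℕ} [NeZero N], IsNewformOf.level_eq_conductorNorm (N := N)) → Core →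
      LeadingTerm.TamePinchR

/-- **A finite `Ш` misses all but finitely many primes of any infinite set of primes.** [folklore] -/
theorem exists_shaPTorsionFree_of_finite (W : WeierstrassCurve ℚ) (hfin : Finite W.sha)
    {S : Set ℕ} (hS : S.Infinite) (hprime : ∀ p ∈ S, p.Prime) :
    ∃ p ∈ S, ShaPTorsionFree W p := by
  haveI : Finite W.sha := hfin
  set M : ℕ := Nat.card W.sha with hM
  have hMpos : 0 < M := Nat.card_pos
  -- the primes of `S` dividing `M` are finitely many
  have hfinS : (S ∩ {p | p ∣ M}).Finite := by
    refine (Finset.finite_toSet (Nat.divisors M)).subset ?_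
    rintro p ⟨-, hp⟩
    exact Nat.mem_divisors.mpr ⟨hp, hMpos.ne'⟩
  obtain ⟨p, hpS, hpM⟩ : ∃ p ∈ S, ¬ p ∣ M := by
    by_contra h
    have hsub : S ⊆ S ∩ {p | p ∣ M} := fun p hp => ⟨hp, by_contra fun hn => h ⟨p, hp, hn⟩⟩
    exact Set.Infinite.mono hsub hS hfinS
  refine ⟨p, hpS, fun c hc hpc => ?_⟩
  have hp : p.Prime := hprime p hpS
  -- the order of `⟨c, hc⟩ ∈ Ш` divides both `p` and `#Ш`, hence is `1`
  let x : W.sha := ⟨c, hc⟩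
  have hx : p • x = 0 := Subtype.ext (by simpa using hpc)
  have h1 : addOrderOf x ∣ p := addOrderOf_dvd_of_nsmul_eq_zero hx
  have h2 : addOrderOf x ∣ M := addOrderOf_dvd_natCard x
  have hone : addOrderOf x = 1 := by
    rcases (Nat.dvd_prime hp).mp h1 with h | h
    · exact h
    · exact absurd (h ▸ h2) hpM
  have : x = 0 := AddMonoid.addOrderOf_eq_one_iff.mp hone
  simpa [x] using congrArg Subtype.val this

/-- **`Core ⟸ Ш finite for non-CM curves + an infinite supply of Kim-good primes.** In particular
`Core` (hence, by `PeelingGlue`, the crux) follows from `ShaFiniteConjecture` and `KimGoodSupply`. -/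
theorem core_of_finite_sha (hsupply : KimGoodSupply)
    (hfin : ∀ (W : WeierstrassCurve ℚ) [W.IsElliptic], ¬ W.HasCM → Finite W.sha) : Core := by
  intro W _ _ hCM
  have hS := hsupply W hCM
  obtain ⟨p, ⟨hp, hgood⟩, hsha⟩ :=
    exists_shaPTorsionFree_of_finite W (hfin W hCM) hS (fun p ⟨hp, _⟩ => hp.out)
  exact ⟨p, hp, hgood, hsha⟩

/-- `ShaFiniteConjecture` (tree, `BSDSha`) gives the finiteness hypothesis of `core_of_finite_sha`. -/
theorem core_of_shaFiniteConjecture (hsupply : KimGoodSupply) (hSha : ShaFiniteConjecture) : Core :=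
  core_of_finite_sha hsupply fun W _ _ => hSha W ‹_›

end KimChebotarevPeeling

/-! ## Card 2: `derived-heegner-indivisibility-twin` -/

namespace HeegnerTwin

open KimChebotarevPeeling

/-- The counting squeeze at one prime (provable from the tree facts `exists_kummerMap`,
`map_torsionH1ToH1_selmerGroup`): if the `p`-Selmer group has at most `p^{rank}` elements and
`E(ℚ)[p] = 0` (automatic for surjective `ρ̄`), the Kummer image `E(ℚ)/p ≅ (ℤ/p)^{rank}` exhausts it,
so `Ш(E)[p] = 0`. -/
def SelmerCountBound : Prop :=
  ∀ (W : WeierstrassCurve ℚ) [W.IsElliptic] (p : ℕ) [Fact p.Prime],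
    (∀ P : W.toAffine.Point, p • P = 0 → P = 0) →
    Nat.card (selmerGroup W (p : ℤ)) ≤ p ^ W.mordellWeilRank → ShaPTorsionFree W p

/-- **Fact shape of Kolyvagin's mod-`p` depth bound (Kolyvagin 1991 / Howard 2004 Kolyvagin-system
form), over a POSITED predicate.** `Indiv W p n` is the D-request "for an imaginary quadratic
Heegner field `K` for `(E, p)` with `corank Sel_{p^∞}(E^K/ℚ) = ord_{s=1} L(E^K, s) ≤ 1`, the
Kolyvagin derivative `D_n y_n ∈ E(K[n])` of the Heegner point of conductor `n` (a square-free
product of Kolyvagin primes for `(E, K, p)`) is NOT `p`-divisible in `E(K[n])` modulo torsion".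
The bound: an indivisible derivative at depth `ν(n) = rank − 1` caps the `p`-Selmer group of
`E/ℚ` by `p^{rank}`. (`rank ≥ 1`; at rank `0` the crux is the rank-zero converse and this card
does not apply.) -/
def KolyvaginDepthBound (Indiv : (W : WeierstrassCurve ℚ) → (p n : ℕ) → Prop) : Prop :=
  ∀ (W : WeierstrassCurve ℚ) [W.IsElliptic] [W.IsGloballyMinimal] (p : ℕ) [Fact p.Prime],
    5 ≤ p → W.HasSurjectiveModNGaloisRep (p : ℤ) → 1 ≤ W.mordellWeilRank →
    ∀ n : ℕ, Squarefree n → n.primeFactors.card + 1 = W.mordellWeilRank → Indiv W p n →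
      Nat.card (selmerGroup W (p : ℤ)) ≤ p ^ W.mordellWeilRank

/-- **The Heegner twin of the pinch (transfer `C⁺_Heeg`)**, over the posited predicate: every non-CM
curve of positive rank has a Kim-good prime `p` and a depth-`(rank − 1)` Kolyvagin conductor `n`
with a `p`-indivisible derived Heegner point. -/
def HeegnerPinch (Indiv : (W : WeierstrassCurve ℚ) → (p n : ℕ) → Prop) : Prop :=
  ∀ (W : WeierstrassCurve ℚ) [W.IsElliptic] [W.IsGloballyMinimal], ¬ W.HasCM →
    1 ≤ W.mordellWeilRank →
    ∃ (p : ℕ) (_ : Fact p.Prime), IsKimGood W p ∧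
      ∃ n : ℕ, Squarefree n ∧ n.primeFactors.card + 1 = W.mordellWeilRank ∧ Indiv W p n

/-- Glue of card 2 in positive rank: `HeegnerPinch ∧ KolyvaginDepthBound ∧ SelmerCountBound ⇒`
the positive-rank part of `Core` (then card 1's `PeelingGlue` finishes). -/
def HeegnerGlue (Indiv : (W : WeierstrassCurve ℚ) → (p n : ℕ) → Prop) : Prop :=
  HeegnerPinch Indiv → KolyvaginDepthBound Indiv → SelmerCountBound →
    ∀ (W : WeierstrassCurve ℚ) [W.IsElliptic] [W.IsGloballyMinimal], ¬ W.HasCM →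
      1 ≤ W.mordellWeilRank → ∃ (p : ℕ) (_ : Fact p.Prime), IsKimGood W p ∧ ShaPTorsionFree W p

/-- The glue of card 2 IS provable now modulo one input: `E(ℚ)[p] = 0` for surjective `ρ̄`
(taken here as the hypothesis `htors`). -/
theorem heegnerGlue_of_torsionFree (Indiv : (W : WeierstrassCurve ℚ) → (p n : ℕ) → Prop)
    (htors : ∀ (W : WeierstrassCurve ℚ) [W.IsElliptic] (p : ℕ) [Fact p.Prime],
      W.HasSurjectiveModNGaloisRep (p : ℤ) → ∀ P : W.toAffine.Point, p • P = 0 → P = 0) :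
    HeegnerGlue Indiv := by
  intro hpinch hdepth hcount W _ _ hCM hr
  obtain ⟨p, hp, hgood, n, hsq, hcard, hind⟩ := hpinch W hCM hr
  refine ⟨p, hp, hgood, ?_⟩
  have hsurj := hgood.2.2.1
  exact hcount W p (htors W p hsurj) (hdepth W p hgood.1 hsurj hr n hsq hcard hind)

end HeegnerTwin

end Summit.BirchSwinnertonDyer.BirchSwinnertonDyer.Cruxes.TamePinchR

end
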